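import Summits.Ventures.HodgeRepro2.A2PontryaginOperator

/-!
# A2PontryaginTable — the multiplication table of the Pontryagin ring on the basis monomials

Tier-4 annex of sub-claim A2 (seat p6, cell pub-hodge-repro2); §8(d): uses an L-value-free
non-vanishing device: NO.

On the basis monomials `e_s = aBasis s` of row 90 (`s` a set of generators) the Pontryagin
product of the model is

  `e_s ⋆ e_t = ± vol • e_{s ∩ t}` if `s ∪ t` is the set of all generators, and `0` otherwise

(`pontryagin_aBasis_aBasis`) — the structure constants of the Pontryagin ring: up to the signs
and the unit `vol`, `(A ι, ⋆)` is the exterior algebra on the DUAL generators (Poincaré duality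
`e_s ↦ e_{sᶜ}` turns `∩` into `∪`), the homology ring of a torus.  Consequently
`e_s ⋆ e_t ≠ 0 ⟺ s ∪ t = everything` (`pontryagin_aBasis_ne_zero_iff`), and the degree count of
row 99 is visible: `|s ∩ t| = |s| + |t| − 2|ι|` when `s ∪ t` is everything.

Proof: row 125's `pontryagin_mono` (`z ⋆ e_t = (ε·vol) • R_{compl} z`) on `z = e_s` with the
monomial rules for the right-contraction list (`contrRList_mono_of_subset`,
`contrRList_mono_eq_zero`) and row 122's `exists_sign_mono_eq_aBasis`.

What stays prose: unchanged (row 125); not on the N1 chain.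
-/

namespace Summit.Ventures.HodgeRepro2.A2PontryaginTable

open WeilPlanes WeilIntegral WeilCoproduct A2ModelDuality A2PontryaginModel A2PontryaginContraction
  A2PontryaginOperator A2HodgeBigrading

variable {ι : Type*} [DecidableEq ι] [Fintype ι]

/-- THE MULTIPLICATION TABLE OF THE PONTRYAGIN RING: `e_s ⋆ e_t = ± vol • e_{s ∩ t}` if
`s ∪ t = univ`, and `0` otherwise. -/
theorem pontryagin_aBasis_aBasis (s t : Finset (Fin (Fintype.card (Gen ι)))) :
    ∃ ε : ℂ, (ε = 1 ∨ ε = -1) ∧ pontryagin (aBasis s) (aBasis t) =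
      if s ∪ t = Finset.univ then (ε * vol ι) • aBasis (s ∩ t) else 0 := by
  obtain ⟨ε, hε, h⟩ := pontryagin_aBasis (ι := ι) t
  rw [h, contrOp, aBasis_apply s]
  by_cases hst : s ∪ t = Finset.univ
  · have hsub : ∀ j ∈ compl (genListOf t), j ∈ genListOf s := by
      intro j hj
      rw [mem_compl, mem_genListOf] at hj
      rw [mem_genListOf]
      have hmem : enum j ∈ s ∪ t := by rw [hst]; exact Finset.mem_univ _
      exact (Finset.mem_union.mp hmem).resolve_right hj
    obtain ⟨ε', hε', h'⟩ := contrRList_mono_of_subset _ (nodup_compl _)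
      (A2LamAdjoint.genListOf_nodup s) hsub
    have hnd : ((genListOf s).filter fun k => decide (k ∉ compl (genListOf t))).Nodup :=
      (A2LamAdjoint.genListOf_nodup s).filter _
    obtain ⟨ε'', hε'', h''⟩ := exists_sign_mono_eq_aBasis hnd
    have hfin : (((genListOf s).filter fun k => decide (k ∉ compl (genListOf t))).map
        enum).toFinset = s ∩ t := by
      ext i
      obtain ⟨j, rfl⟩ := enum.surjective i
      simp [mem_compl, mem_genListOf, List.mem_filter]
    refine ⟨ε * ε' * ε'', ?_, ?_⟩
    · rcases hε with rfl | rfl <;> rcases hε' with rfl | rfl <;> rcases hε'' with rfl | rfl <;> simp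
    · rw [if_pos hst, h', h'', hfin, smul_smul, smul_smul]
      congr 1
      ring
  · refine ⟨1, Or.inl rfl, ?_⟩
    have hne : ∃ j ∈ compl (genListOf t), j ∉ genListOf s := by
      obtain ⟨i, hi⟩ := not_forall.mp (mt Finset.eq_univ_iff_forall.mpr hst)
      obtain ⟨j, rfl⟩ := enum.surjective i
      rw [Finset.mem_union, not_or] at hi
      exact ⟨j, mem_compl.mpr ((mem_genListOf _ _).not.mpr hi.2), (mem_genListOf _ _).not.mpr hi.1⟩
    rw [if_neg hst, contrRList_mono_eq_zero _ (A2LamAdjoint.genListOf_nodup s) hne, smul_zero]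

/-- `e_s ⋆ e_t ≠ 0 ⟺ s ∪ t = univ`. -/
theorem pontryagin_aBasis_ne_zero_iff (s t : Finset (Fin (Fintype.card (Gen ι)))) :
    pontryagin (aBasis s) (aBasis t) ≠ 0 ↔ s ∪ t = Finset.univ := by
  obtain ⟨ε, hε, h⟩ := pontryagin_aBasis_aBasis (ι := ι) s t
  rw [h]
  by_cases hst : s ∪ t = Finset.univ
  · rw [if_pos hst]
    refine ⟨fun _ => hst, fun _ => ?_⟩
    refine smul_ne_zero (mul_ne_zero ?_ (vol_ne_zero ι)) (aBasis.ne_zero _)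
    rcases hε with rfl | rfl <;> simp
  · rw [if_neg hst]
    simp [hst]

/-- The product of two basis monomials lies in the degree `|s| + |t| − 2|ι|` (row 99's degree
count read on the table). -/
theorem pontryagin_aBasis_aBasis_mem_grading (s t : Finset (Fin (Fintype.card (Gen ι))))
    (hst : s ∪ t = Finset.univ) :
    pontryagin (aBasis s) (aBasis t) ∈ grading ι (s.card + t.card - Fintype.card (Gen ι)) := by
  obtain ⟨ε, -, h⟩ := pontryagin_aBasis_aBasis (ι := ι) s t
  rw [h, if_pos hst]
  have hc : (s ∩ t).card = s.card + t.card - Fintype.card (Gen ι) := by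
    have h1 := Finset.card_union_add_card_inter s t
    rw [hst, Finset.card_univ, Fintype.card_fin] at h1
    omega
  rw [← hc]
  exact Submodule.smul_mem _ _ (A2PontryaginDegree.aBasis_mem_grading _)

end Summit.Ventures.HodgeRepro2.A2PontryaginTable
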